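import Literature.IUT.LogVolume.Corollary22Statement
import Literature.NumberTheory.DiophantineGeometry.GenEllNorthcottProofs
import HarnessLib

/-!
# [IUTchIV] Corollary 2.2 (iii): the `ε_E`-threshold computation and the finiteness of the
# small-`log(q^∀)` locus — PROOF-ONLY core

Mochizuki, *Inter-universal Teichmüller theory IV*, RIMS manuscript (Apr. 2020; = PRIMS **57** (2021)),
Cor. 2.2 (iii), p. 43: "the positive real number `H_unif` (which is independent of `K_V`!) may be chosen
in such a way that … there exists a finite subset `Exc_{ε,d} ⊆ U_X(ℚ̄)^{≤d}` … such that … the function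
`log(q^∀_{(−)})` is `≤ H_unif·ε^{−3}·ε_d^{−3}·d^{4+ε_d} + H_K` on `Exc_{ε,d}`, and … `E_F` satisfies the
condition `ε_E ≤ ε`, whenever … `x_E ∉ Exc_{ε,d}`", where (Cor. 2.2 (ii), p. 42)
`ε_E := (60δ)²·log(2δ·log(q^∀))/log(q^∀)^{1/2}`, `δ := 2^12·3^3·5·d`.

This file PROVES the two mathematical ingredients of (iii), over S3's definitions `Cor22.delta`,
`Cor22.epsilonE`, `Cor22.logQForall` (`Corollary22Statement.lean`), independently of how the
exceptional set is packaged (see the note below):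

* `exists_threshold_epsilonE_le` — the ELEMENTARY COMPUTATION: there is an absolute constant `H₃ > 0`
  such that for every `H_unif ≥ H₃`, every `d ≥ 1`, `ε_d, ε ∈ (0, 1]` and every presented point `P` with
  `log(q^∀)(P) ≥ H_unif·ε^{−3}·ε_d^{−3}·d^{4+ε_d}` one has `ε_E(P) ≤ ε`.  (Log-absorption with exponent
  `ε_d/10`: the `d`-exponent `20/(5−ε_d)` is `≤ 4+ε_d` exactly because `ε_d(1−ε_d) ≥ 0`; the `log(2δ)`
  term is absorbed by `log x ≤ x^s/s` as well.  The constant produced here is astronomically larger than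
  necessary; only its independence of `K_V`, `d`, `ε_d`, `ε` and of the point matters.)
* `hasFinitelyManyPoints_logQForall_le` — FINITENESS: if `ht ≲ (1/6)·log(q^∀)` on `K_V` (the second and
  third bounded-discrepancy equivalences of Cor. 2.2 (i)), then for every `d` and `B` the locus
  `{P ∈ K_V ∩ U_X(ℚ̄)^{≤d} | log(q^∀)(P) ≤ B}` has finitely many points in the sense of [GenEll] Ex. 1.3 (i)
  (`HasFinitelyManyPoints`: finitely many minimal polynomials), by Northcott for `U_P(ℚ̄)^{≤d}`
  (`northcott_UPle_holds`, tree).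

NOTE on the packaging: `Cor22.PartIII` (as repaired in p405792) counts the exceptional set through
minimal polynomials (`HasFinitelyManyPoints Exc`), because a ℚ̄-point has infinitely many PRESENTATIONS
`NFPoint` and `Set.Finite` could not remove any point; the two theorems below are exactly the ingredients
that statement needs (the assembly `Cor22.PartIII D H_unif` for `H_unif ≥ H₃` is in
`Corollary22PartIII.lean`).  Classical content (real analysis + Northcott); nothing here takes a side on
[IUTchIII] Cor. 3.12 or asserts abc.  No new definitions.
-/

noncomputable section

namespace Literature.IUT.LogVolume

namespace Cor22

open Real NumberField Literature.NumberTheory.DiophantineGeometry.GenEll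

/-! ## Elementary real-analysis lemmas for the `ε_E`-threshold -/

/-- Log-absorption, the `log h` part: if `0 < s ≤ 1/10` and `h ≥ (2A/(εs))^{2/(1−2s)}`, then
`A·log h ≤ (ε/2)·√h` (from `log h ≤ h^s/s`). [folklore] -/
private theorem mul_log_le_half_sqrt {A ε s h : ℝ} (hA : 0 < A) (hε : 0 < ε) (hs : 0 < s)
    (hs' : s ≤ 1 / 10) (h0 : 0 < h) (hthr : (2 * A / (ε * s)) ^ (2 / (1 - 2 * s)) ≤ h) :
    A * Real.log h ≤ ε / 2 * Real.sqrt h := by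
  set X : ℝ := 2 * A / (ε * s) with hXdef
  have hX0 : 0 < X := by positivity
  have h12s : 0 < 1 - 2 * s := by linarith
  -- `X ≤ h ^ (1/2 - s)`
  have hX : X ≤ h ^ (1 / 2 - s) := by
    have hmul : 2 / (1 - 2 * s) * (1 / 2 - s) = 1 := by
      field_simp
    calc X = (X ^ (2 / (1 - 2 * s))) ^ (1 / 2 - s) := by
          rw [← Real.rpow_mul hX0.le, hmul, Real.rpow_one]
      _ ≤ h ^ (1 / 2 - s) := Real.rpow_le_rpow (by positivity) hthr (by linarith)
  have hlog : Real.log h ≤ h ^ s / s := Real.log_le_rpow_div h0.le hs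
  have hhs : 0 < h ^ s := Real.rpow_pos_of_pos h0 s
  have hAs : A / s ≤ ε / 2 * h ^ (1 / 2 - s) := by
    have := mul_le_mul_of_nonneg_left hX (by positivity : (0 : ℝ) ≤ ε / 2)
    calc A / s = ε / 2 * X := by rw [hXdef]; field_simp
      _ ≤ ε / 2 * h ^ (1 / 2 - s) := this
  have hsqrt : Real.sqrt h = h ^ (1 / 2 - s) * h ^ s := by
    rw [Real.sqrt_eq_rpow, ← Real.rpow_add h0]
    ring_nf
  calc A * Real.log h ≤ A * (h ^ s / s) := mul_le_mul_of_nonneg_left hlog hA.le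
    _ = A / s * h ^ s := by ring
    _ ≤ ε / 2 * h ^ (1 / 2 - s) * h ^ s := mul_le_mul_of_nonneg_right hAs hhs.le
    _ = ε / 2 * Real.sqrt h := by rw [hsqrt]; ring

/-- The constant part: if `0 ≤ L` and `h ≥ (2AL/ε)²`, then `A·L ≤ (ε/2)·√h`. [folklore] -/
private theorem mul_const_le_half_sqrt {A ε L h : ℝ} (hA : 0 < A) (hε : 0 < ε) (hL : 0 ≤ L)
    (hthr : (2 * A * L / ε) ^ 2 ≤ h) : A * L ≤ ε / 2 * Real.sqrt h := by
  have h1 : 2 * A * L / ε ≤ Real.sqrt h :=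
    (Real.le_sqrt (by positivity) (le_trans (sq_nonneg _) hthr)).mpr hthr
  have := mul_le_mul_of_nonneg_left h1 (by positivity : (0 : ℝ) ≤ ε / 2)
  calc A * L = ε / 2 * (2 * A * L / ε) := by field_simp
    _ ≤ ε / 2 * Real.sqrt h := this

/-- `log(2δ) = log(1105920·d) ≤ (2211840/ε_d)·d^{ε_d/2}` for `d ≥ 1`, `0 < ε_d ≤ 1`
(from `log x ≤ x^s/s` with `s = ε_d/2` and `1105920^{ε_d/2} ≤ 1105920`). [folklore] -/
private theorem log_two_delta_le {d : ℕ} (hd : 1 ≤ d) {εd : ℝ} (h0 : 0 < εd) (h1 : εd ≤ 1) :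
    Real.log (2 * delta d) ≤ 2211840 / εd * (d : ℝ) ^ (εd / 2) := by
  have hd' : (1 : ℝ) ≤ d := by exact_mod_cast hd
  have h2δ : 2 * delta d = 1105920 * (d : ℝ) := by unfold delta; ring
  rw [h2δ]
  have hs : 0 < εd / 2 := by positivity
  have hlog := Real.log_le_rpow_div (x := 1105920 * (d : ℝ)) (by positivity) hs
  have hsplit : (1105920 * (d : ℝ)) ^ (εd / 2) = (1105920 : ℝ) ^ (εd / 2) * (d : ℝ) ^ (εd / 2) :=
    Real.mul_rpow (by norm_num) (by positivity)
  have hc : (1105920 : ℝ) ^ (εd / 2) ≤ 1105920 := by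
    calc (1105920 : ℝ) ^ (εd / 2) ≤ (1105920 : ℝ) ^ (1 : ℝ) :=
          Real.rpow_le_rpow_of_exponent_le (by norm_num) (by linarith)
      _ = 1105920 := Real.rpow_one _
  have hdpow : 0 ≤ (d : ℝ) ^ (εd / 2) := Real.rpow_nonneg (by positivity) _
  calc Real.log (1105920 * (d : ℝ)) ≤ (1105920 * (d : ℝ)) ^ (εd / 2) / (εd / 2) := hlog
    _ = 2 / εd * ((1105920 : ℝ) ^ (εd / 2) * (d : ℝ) ^ (εd / 2)) := by rw [hsplit]; field_simp
    _ ≤ 2 / εd * (1105920 * (d : ℝ) ^ (εd / 2)) := by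
        gcongr
    _ = 2211840 / εd * (d : ℝ) ^ (εd / 2) := by ring

/-- The threshold of the `log h` part, `(20·a₀·d²/(ε·ε_d))^{10/(5−ε_d)}` (`s = ε_d/10`), is at most
`(20a₀)³·ε^{−3}·ε_d^{−3}·d^{4+ε_d}`: the `d`-exponent `20/(5−ε_d)` is `≤ 4 + ε_d` because `ε_d(1−ε_d) ≥ 0`,
and the other exponents are `≤ 3`. [folklore] -/
private theorem threshold_log_le {a₀ : ℝ} (ha : 1 ≤ a₀) {d : ℕ} (hd : 1 ≤ d) {εd : ℝ} (h0 : 0 < εd)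
    (h1 : εd ≤ 1) {ε : ℝ} (e0 : 0 < ε) (e1 : ε ≤ 1) :
    (2 * (a₀ * (d : ℝ) ^ 2) / (ε * (εd / 10))) ^ (2 / (1 - 2 * (εd / 10))) ≤
      (20 * a₀) ^ 3 * (ε ^ (-(3 : ℝ)) * εd ^ (-(3 : ℝ)) * (d : ℝ) ^ (4 + εd)) := by
  have hd' : (1 : ℝ) ≤ d := by exact_mod_cast hd
  set e : ℝ := 2 / (1 - 2 * (εd / 10)) with he_def
  have h5 : 0 < 5 - εd := by linarith
  have hne : (5 : ℝ) - εd ≠ 0 := h5.ne'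
  have hne' : (1 : ℝ) - 2 * (εd / 10) ≠ 0 := by
    intro h; apply hne; linarith
  have he : e = 10 / (5 - εd) := by rw [he_def, div_eq_div_iff hne' hne]; ring
  have he0 : 0 ≤ e := by rw [he]; positivity
  have he3 : e ≤ 3 := by
    rw [he, div_le_iff₀ h5]; linarith
  have h2e : 2 * e ≤ 4 + εd := by
    rw [he, mul_div_assoc', div_le_iff₀ h5]
    nlinarith
  -- rewrite the base as a product of four factors `≥ 1`
  have hbase : 2 * (a₀ * (d : ℝ) ^ 2) / (ε * (εd / 10)) =
      (20 * a₀) * (d : ℝ) ^ 2 * ε⁻¹ * εd⁻¹ := by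
    field_simp
    ring
  rw [hbase]
  have f1 : (1 : ℝ) ≤ 20 * a₀ := by linarith
  have f2 : (1 : ℝ) ≤ (d : ℝ) ^ 2 := one_le_pow₀ hd'
  have f3 : (1 : ℝ) ≤ ε⁻¹ := one_le_inv_iff₀.mpr ⟨e0, e1⟩
  have f4 : (1 : ℝ) ≤ εd⁻¹ := one_le_inv_iff₀.mpr ⟨h0, h1⟩
  rw [Real.mul_rpow (by positivity) (by positivity), Real.mul_rpow (by positivity) (by positivity),
    Real.mul_rpow (by positivity) (by positivity)]
  -- factor by factor
  have g1 : (20 * a₀) ^ e ≤ (20 * a₀) ^ 3 := by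
    calc (20 * a₀) ^ e ≤ (20 * a₀) ^ (3 : ℝ) := Real.rpow_le_rpow_of_exponent_le f1 he3
      _ = (20 * a₀) ^ 3 := by exact_mod_cast Real.rpow_natCast (20 * a₀) 3
  have g2 : ((d : ℝ) ^ 2) ^ e ≤ (d : ℝ) ^ (4 + εd) := by
    have : ((d : ℝ) ^ 2) ^ e = (d : ℝ) ^ (2 * e) := by
      rw [show ((d : ℝ) ^ 2) = (d : ℝ) ^ (2 : ℝ) by exact_mod_cast (Real.rpow_natCast (d : ℝ) 2).symm,
        ← Real.rpow_mul (by positivity)]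
    rw [this]
    exact Real.rpow_le_rpow_of_exponent_le hd' h2e
  have g3 : (ε⁻¹) ^ e ≤ ε ^ (-(3 : ℝ)) := by
    rw [Real.inv_rpow e0.le, ← Real.rpow_neg e0.le]
    exact Real.rpow_le_rpow_of_exponent_ge e0 e1 (by linarith)
  have g4 : (εd⁻¹) ^ e ≤ εd ^ (-(3 : ℝ)) := by
    rw [Real.inv_rpow h0.le, ← Real.rpow_neg h0.le]
    exact Real.rpow_le_rpow_of_exponent_ge h0 h1 (by linarith)
  have p1 : 0 ≤ (20 * a₀) ^ e := Real.rpow_nonneg (by positivity) _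
  have p2 : 0 ≤ ((d : ℝ) ^ 2) ^ e := Real.rpow_nonneg (by positivity) _
  have p3 : 0 ≤ (ε⁻¹) ^ e := Real.rpow_nonneg (by positivity) _
  have p4 : 0 ≤ (εd⁻¹) ^ e := Real.rpow_nonneg (by positivity) _
  have q3 : 0 ≤ ε ^ (-(3 : ℝ)) := Real.rpow_nonneg e0.le _
  calc (20 * a₀) ^ e * ((d : ℝ) ^ 2) ^ e * ε⁻¹ ^ e * εd⁻¹ ^ e
      ≤ (20 * a₀) ^ 3 * (d : ℝ) ^ (4 + εd) * ε ^ (-(3 : ℝ)) * εd ^ (-(3 : ℝ)) := by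
        gcongr
    _ = (20 * a₀) ^ 3 * (ε ^ (-(3 : ℝ)) * εd ^ (-(3 : ℝ)) * (d : ℝ) ^ (4 + εd)) := by ring

/-- The threshold of the constant part, `(2·A·L′/ε)²` with `A = a₀d²`, `L′ = (2211840/ε_d)·d^{ε_d/2}`, is
at most `(4423680·a₀)²·ε^{−3}·ε_d^{−3}·d^{4+ε_d}`. [folklore] -/
private theorem threshold_const_le {a₀ : ℝ} (ha : 1 ≤ a₀) {d : ℕ} (hd : 1 ≤ d) {εd : ℝ} (h0 : 0 < εd)
    (h1 : εd ≤ 1) {ε : ℝ} (e0 : 0 < ε) (e1 : ε ≤ 1) :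
    (2 * (a₀ * (d : ℝ) ^ 2) * (2211840 / εd * (d : ℝ) ^ (εd / 2)) / ε) ^ 2 ≤
      (4423680 * a₀) ^ 2 * (ε ^ (-(3 : ℝ)) * εd ^ (-(3 : ℝ)) * (d : ℝ) ^ (4 + εd)) := by
  have hd' : (1 : ℝ) ≤ d := by exact_mod_cast hd
  have hdp : (0 : ℝ) < d := by positivity
  have f3 : (1 : ℝ) ≤ ε⁻¹ := one_le_inv_iff₀.mpr ⟨e0, e1⟩
  have f4 : (1 : ℝ) ≤ εd⁻¹ := one_le_inv_iff₀.mpr ⟨h0, h1⟩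
  -- normal forms of the powers involved
  have hsq : ((d : ℝ) ^ (εd / 2)) ^ 2 = (d : ℝ) ^ εd := by
    rw [show (((d : ℝ) ^ (εd / 2)) ^ 2) = ((d : ℝ) ^ (εd / 2)) ^ (2 : ℝ) by
        exact_mod_cast (Real.rpow_natCast ((d : ℝ) ^ (εd / 2)) 2).symm,
      ← Real.rpow_mul hdp.le]
    ring_nf
  have hε3 : ε ^ (-(3 : ℝ)) = (ε⁻¹) ^ 3 := by
    rw [Real.rpow_neg e0.le, show (3 : ℝ) = ((3 : ℕ) : ℝ) by norm_num, Real.rpow_natCast, inv_pow]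
  have hεd3 : εd ^ (-(3 : ℝ)) = (εd⁻¹) ^ 3 := by
    rw [Real.rpow_neg h0.le, show (3 : ℝ) = ((3 : ℕ) : ℝ) by norm_num, Real.rpow_natCast, inv_pow]
  have hd4 : (d : ℝ) ^ (4 + εd) = (d : ℝ) ^ 4 * (d : ℝ) ^ εd := by
    rw [Real.rpow_add hdp, show (4 : ℝ) = ((4 : ℕ) : ℝ) by norm_num, Real.rpow_natCast]
  have hlhs : (2 * (a₀ * (d : ℝ) ^ 2) * (2211840 / εd * (d : ℝ) ^ (εd / 2)) / ε) ^ 2 =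
      (4423680 * a₀) ^ 2 * ((d : ℝ) ^ 4 * (d : ℝ) ^ εd) * ((ε⁻¹) ^ 2 * (εd⁻¹) ^ 2) := by
    rw [← hsq]
    field_simp
    ring
  rw [hlhs, hε3, hεd3, hd4]
  have hpow : (ε⁻¹) ^ 2 * (εd⁻¹) ^ 2 ≤ (ε⁻¹) ^ 3 * (εd⁻¹) ^ 3 := by
    have hu : (1 : ℝ) ≤ ε⁻¹ * εd⁻¹ := one_le_mul_of_one_le_of_one_le f3 f4
    have hnn : (0 : ℝ) ≤ (ε⁻¹) ^ 2 * (εd⁻¹) ^ 2 := by positivity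
    calc (ε⁻¹) ^ 2 * (εd⁻¹) ^ 2 = (ε⁻¹) ^ 2 * (εd⁻¹) ^ 2 * 1 := (mul_one _).symm
      _ ≤ (ε⁻¹) ^ 2 * (εd⁻¹) ^ 2 * (ε⁻¹ * εd⁻¹) := mul_le_mul_of_nonneg_left hu hnn
      _ = (ε⁻¹) ^ 3 * (εd⁻¹) ^ 3 := by ring
  have hdd : (0 : ℝ) ≤ (d : ℝ) ^ 4 * (d : ℝ) ^ εd := by positivity
  calc (4423680 * a₀) ^ 2 * ((d : ℝ) ^ 4 * (d : ℝ) ^ εd) * ((ε⁻¹) ^ 2 * (εd⁻¹) ^ 2)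
      ≤ (4423680 * a₀) ^ 2 * ((d : ℝ) ^ 4 * (d : ℝ) ^ εd) * ((ε⁻¹) ^ 3 * (εd⁻¹) ^ 3) := by
        gcongr
    _ = (4423680 * a₀) ^ 2 * ((ε⁻¹) ^ 3 * (εd⁻¹) ^ 3 * ((d : ℝ) ^ 4 * (d : ℝ) ^ εd)) := by ring

/-- **The elementary computation behind [IUTchIV] Cor. 2.2 (iii)** (p. 43), real-variable form: there is an
absolute constant `H₃ > 0` such that for all `H ≥ H₃`, `d ≥ 1`, `ε_d, ε ∈ (0,1]` and every real
`h ≥ H·ε^{−3}·ε_d^{−3}·d^{4+ε_d}` one has `(60δ)²·log(2δh)/√h ≤ ε` (`δ = 2^12·3^3·5·d`), i.e. the quantity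
`ε_E` of Cor. 2.2 (ii) evaluated at `log(q^∀) = h` is `≤ ε`. [claim: Mochizuki2012, status: disputed] -/
theorem exists_threshold_sixtyDeltaSq_log_div_sqrt_le :
    ∃ H₃ : ℝ, 0 < H₃ ∧ ∀ H : ℝ, H₃ ≤ H → ∀ d : ℕ, 1 ≤ d → ∀ εd : ℝ, 0 < εd → εd ≤ 1 →
      ∀ ε : ℝ, 0 < ε → ε ≤ 1 → ∀ h : ℝ,
        H * ε ^ (-(3 : ℝ)) * εd ^ (-(3 : ℝ)) * (d : ℝ) ^ (4 + εd) ≤ h →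
          (60 * delta d) ^ 2 * Real.log (2 * delta d * h) / Real.sqrt h ≤ ε := by
  set a₀ : ℝ := 3600 * 552960 ^ 2 with ha₀
  have ha : (1 : ℝ) ≤ a₀ := by rw [ha₀]; norm_num
  refine ⟨(4423680 * a₀) ^ 2 + (20 * a₀) ^ 3, by positivity, ?_⟩
  intro H hH d hd εd h0 h1 ε e0 e1 h hh
  have hd' : (1 : ℝ) ≤ d := by exact_mod_cast hd
  have hdp : (0 : ℝ) < d := by positivity
  -- the common factor `M = ε^{-3} ε_d^{-3} d^{4+ε_d} ≥ 1`
  set M : ℝ := ε ^ (-(3 : ℝ)) * εd ^ (-(3 : ℝ)) * (d : ℝ) ^ (4 + εd) with hM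
  have hM1 : 1 ≤ M := by
    have m1 : (1 : ℝ) ≤ ε ^ (-(3 : ℝ)) := Real.one_le_rpow_of_pos_of_le_one_of_nonpos e0 e1 (by norm_num)
    have m2 : (1 : ℝ) ≤ εd ^ (-(3 : ℝ)) := Real.one_le_rpow_of_pos_of_le_one_of_nonpos h0 h1 (by norm_num)
    have m3 : (1 : ℝ) ≤ (d : ℝ) ^ (4 + εd) := Real.one_le_rpow hd' (by linarith)
    rw [hM]
    exact one_le_mul_of_one_le_of_one_le (one_le_mul_of_one_le_of_one_le m1 m2) m3
  have hM0 : 0 ≤ M := zero_le_one.trans hM1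
  have hHM : H * M ≤ h := by rw [hM, ← mul_assoc, ← mul_assoc]; exact hh
  have hH0 : 0 ≤ H := le_trans (by positivity) hH
  have hhpos : 0 < h := by
    have : (4423680 * a₀) ^ 2 + (20 * a₀) ^ 3 ≤ h :=
      le_trans (le_trans (le_mul_of_one_le_right (by positivity) hM1)
        (mul_le_mul_of_nonneg_right hH hM0)) hHM
    exact lt_of_lt_of_le (by positivity) this
  -- `A = (60δ)² = a₀ d²`
  have hA : (60 * delta d) ^ 2 = a₀ * (d : ℝ) ^ 2 := by rw [ha₀]; unfold delta; ring
  have hApos : 0 < a₀ * (d : ℝ) ^ 2 := by positivity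
  -- (b) the `log h` part
  have hb : a₀ * (d : ℝ) ^ 2 * Real.log h ≤ ε / 2 * Real.sqrt h := by
    refine mul_log_le_half_sqrt hApos e0 (by positivity : 0 < εd / 10) (by linarith) hhpos ?_
    calc (2 * (a₀ * (d : ℝ) ^ 2) / (ε * (εd / 10))) ^ (2 / (1 - 2 * (εd / 10)))
        ≤ (20 * a₀) ^ 3 * M := threshold_log_le ha hd h0 h1 e0 e1
      _ ≤ H * M := mul_le_mul_of_nonneg_right (le_trans (by nlinarith [sq_nonneg (4423680 * a₀)]) hH) hM0
      _ ≤ h := hHM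
  -- (a) the constant part `log(2δ)`
  have hL0 : 0 ≤ Real.log (2 * delta d) := by
    apply Real.log_nonneg
    have : 2 * delta d = 1105920 * (d : ℝ) := by unfold delta; ring
    rw [this]; nlinarith
  have haux : a₀ * (d : ℝ) ^ 2 * (2211840 / εd * (d : ℝ) ^ (εd / 2)) ≤ ε / 2 * Real.sqrt h := by
    refine mul_const_le_half_sqrt hApos e0 (by positivity) ?_
    calc (2 * (a₀ * (d : ℝ) ^ 2) * (2211840 / εd * (d : ℝ) ^ (εd / 2)) / ε) ^ 2
        ≤ (4423680 * a₀) ^ 2 * M := threshold_const_le ha hd h0 h1 e0 e1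
      _ ≤ H * M := mul_le_mul_of_nonneg_right (le_trans (by nlinarith [pow_nonneg (by positivity : (0:ℝ) ≤ 20 * a₀) 3]) hH) hM0
      _ ≤ h := hHM
  have haa : a₀ * (d : ℝ) ^ 2 * Real.log (2 * delta d) ≤ ε / 2 * Real.sqrt h :=
    le_trans (mul_le_mul_of_nonneg_left (log_two_delta_le hd h0 h1) hApos.le) haux
  -- assemble
  have h2δ : 2 * delta d ≠ 0 := by unfold delta; positivity
  have hsplit : Real.log (2 * delta d * h) = Real.log (2 * delta d) + Real.log h :=
    Real.log_mul h2δ hhpos.ne'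
  have hsqrt : 0 < Real.sqrt h := Real.sqrt_pos.mpr hhpos
  rw [div_le_iff₀ hsqrt, hA, hsplit, mul_add]
  linarith

/-! ## The `ε_E`-threshold for presented points -/

/-- **[IUTchIV] Cor. 2.2 (iii), the `ε_E ≤ ε` computation** (p. 43; `ε_E` as in Cor. 2.2 (ii) p. 42,
"`ε_E := (60δ)²·log(2δ·log(q^∀))/log(q^∀)^{1/2}`"): there is an absolute `H₃ > 0` such that for every
`H_unif ≥ H₃`, every `d ≥ 1`, `ε_d, ε ∈ (0,1]` and every presented point `P` with
`log(q^∀)(P) ≥ H_unif·ε^{−3}·ε_d^{−3}·d^{4+ε_d}`, `ε_E(P) ≤ ε` — over S3's `Cor22.epsilonE`, `Cor22.logQForall`.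
Independent of `K_V` and of the disputed chain. [claim: Mochizuki2012, status: disputed] -/
theorem exists_threshold_epsilonE_le :
    ∃ H₃ : ℝ, 0 < H₃ ∧ ∀ Hunif : ℝ, H₃ ≤ Hunif → ∀ d : ℕ, 1 ≤ d → ∀ εd : ℝ, 0 < εd → εd ≤ 1 →
      ∀ ε : ℝ, 0 < ε → ε ≤ 1 → ∀ P : NFPoint,
        Hunif * ε ^ (-(3 : ℝ)) * εd ^ (-(3 : ℝ)) * (d : ℝ) ^ (4 + εd) ≤ logQForall P →
          epsilonE d P ≤ ε := by
  obtain ⟨H₃, hH₃, h⟩ := exists_threshold_sixtyDeltaSq_log_div_sqrt_le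
  exact ⟨H₃, hH₃, fun Hunif hH d hd εd h0 h1 ε e0 e1 P hP => h Hunif hH d hd εd h0 h1 ε e0 e1 _ hP⟩

/-! ## Finiteness of the small-`log(q^∀)` locus of `K_V ∩ U_X(ℚ̄)^{≤d}` -/

/-- **[IUTchIV] Cor. 2.2 (iii), finiteness of the exceptional locus** (p. 43: "a finite subset
`Exc_{ε,d} ⊆ U_X(ℚ̄)^{≤d}` … on which `log(q^∀)` is `≤ …`"): if `ht_{ω_X(D)} ≲ (1/6)·log(q^∀)` on `K_V`
(consequence of the equalities of BD-classes of Cor. 2.2 (i)), then for every `d` and every bound `B`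
the points of `K_V ∩ U_X(ℚ̄)^{≤d}` with `log(q^∀) ≤ B` are finitely many in the sense of [GenEll] Ex. 1.3 (i)
(finitely many minimal polynomials), by Northcott for `U_P(ℚ̄)^{≤d}` (`northcott_UPle_holds`).
[claim: Mochizuki2012, status: disputed] -/
theorem hasFinitelyManyPoints_logQForall_le (D : CBData)
    (hht : BDLe D.toSet NFPoint.ht (fun P => 1 / 6 * logQForall P)) (d : ℕ) (B : ℝ) :
    HasFinitelyManyPoints {P | P ∈ D.toSet ∩ UPle d ∧ logQForall P ≤ B} := by
  obtain ⟨C, hC⟩ := hht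
  refine (northcott_UPle_holds d (C + 1 / 6 * B)).mono ?_
  rintro P ⟨⟨hPD, hPd⟩, hPB⟩
  refine ⟨hPd, ?_⟩
  have h := hC P hPD
  simp only at h
  linarith

/-- The same finiteness from the two relevant equalities of BD-classes of Cor. 2.2 (i) themselves
(`(1/6)·log(q^∀) ≈ (1/6)·ht_∞ ≈ ht_{ω_X(D)}` on `K_V`, the second and third conjuncts of `Cor22.PartI`).
[claim: Mochizuki2012, status: disputed] -/
theorem hasFinitelyManyPoints_logQForall_le_of_bdEquiv (D : CBData)
    (h12 : BDEquiv D.toSet (fun P => 1 / 6 * logQForall P) (fun P => 1 / 6 * htInfty P))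
    (h23 : BDEquiv D.toSet (fun P => 1 / 6 * htInfty P) NFPoint.ht) (d : ℕ) (B : ℝ) :
    HasFinitelyManyPoints {P | P ∈ D.toSet ∩ UPle d ∧ logQForall P ≤ B} :=
  hasFinitelyManyPoints_logQForall_le D (h23.symm.trans h12.symm).bdLe d B

/-- In particular from `Cor22.PartI D`. [claim: Mochizuki2012, status: disputed] -/
theorem hasFinitelyManyPoints_logQForall_le_of_partI (D : CBData) (hI : PartI D) (d : ℕ) (B : ℝ) :
    HasFinitelyManyPoints {P | P ∈ D.toSet ∩ UPle d ∧ logQForall P ≤ B} :=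
  hasFinitelyManyPoints_logQForall_le_of_bdEquiv D hI.2.1 hI.2.2 d B

end Cor22

end Literature.IUT.LogVolume

end
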